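import Mathlib
import Summits.Parity.BatemanHorn.Theses.AlmostPrimeZeros

/-!
# Hadamard bookkeeping for polynomials (route AlmostPrimeZeros, item stmt-Parity-8827)

For every `P ∈ ℂ[z]` with `P(1) ≠ 0` and every `z ∈ ℂ`,
`|P(z)| ≤ |P(1)| · exp(−Re[(1−z)P′(1)/P(1)] + ½|1−z|² Σ_ρ |1−ρ|⁻²)`,
the sum running over the roots `ρ` of `P` with multiplicity.

Proof: `P(z)/P(1) = ∏_ρ (1 − u_ρ)` with `u_ρ = (1−z)/(1−ρ)`; pointwise
`|1−u|² = 1 − 2 Re u + |u|² ≤ exp(−2 Re u + |u|²)`; and `Σ_ρ u_ρ = (1−z)P′(1)/P(1)` by the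
logarithmic derivative at the non-root `1` (`Polynomial.Splits.eval_derivative_div_eval_of_ne_zero`).
-/

namespace Summit.Parity.BatemanHorn.Theorems

open Polynomial

/-- The primary-factor bound `‖1 − u‖ ≤ exp (−Re u + ‖u‖² / 2)`, from `1 + t ≤ eᵗ` at
`t = −2 Re u + ‖u‖²`. -/
theorem hadamardBookkeeping_norm_one_sub_le (u : ℂ) :
    ‖1 - u‖ ≤ Real.exp (-u.re + ‖u‖ ^ 2 / 2) := by
  have h1 : ‖1 - u‖ ^ 2 = 1 - 2 * u.re + ‖u‖ ^ 2 := by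
    rw [Complex.sq_norm, Complex.sq_norm, Complex.normSq_apply, Complex.normSq_apply]
    simp only [Complex.sub_re, Complex.one_re, Complex.sub_im, Complex.one_im]
    ring
  have h2 : ‖1 - u‖ ^ 2 ≤ Real.exp (-u.re + ‖u‖ ^ 2 / 2) ^ 2 := by
    rw [h1, ← Real.exp_nat_mul]
    have h3 : ((2 : ℕ) : ℝ) * (-u.re + ‖u‖ ^ 2 / 2) = -2 * u.re + ‖u‖ ^ 2 := by
      push_cast; ring
    rw [h3]
    have := Real.add_one_le_exp (-2 * u.re + ‖u‖ ^ 2)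
    linarith
  exact (pow_le_pow_iff_left₀ (norm_nonneg _) (Real.exp_nonneg _) two_ne_zero).1 h2

/-- One factor: `‖z − ρ‖ ≤ ‖1 − ρ‖ · exp (−Re u + ‖1−z‖² (‖1−ρ‖²)⁻¹ / 2)` with
`u = (1 − z) · (1 − ρ)⁻¹`, valid when `ρ ≠ 1`. -/
theorem hadamardBookkeeping_factor_le (z ρ : ℂ) (hρ : 1 - ρ ≠ 0) :
    ‖z - ρ‖ ≤ ‖1 - ρ‖ * Real.exp (-((1 - z) * (1 / (1 - ρ))).re
      + (1 / 2) * ‖1 - z‖ ^ 2 * (‖(1 : ℂ) - ρ‖ ^ 2)⁻¹) := by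
  set u : ℂ := (1 - z) * (1 / (1 - ρ)) with hu
  have hfac : z - ρ = (1 - ρ) * (1 - u) := by
    rw [hu]; field_simp; ring
  have hnorm : ‖u‖ ^ 2 / 2 = (1 / 2) * ‖1 - z‖ ^ 2 * (‖(1 : ℂ) - ρ‖ ^ 2)⁻¹ := by
    rw [hu, norm_mul, norm_div, norm_one]
    ring
  rw [hfac, norm_mul, ← hnorm]
  exact mul_le_mul_of_nonneg_left (hadamardBookkeeping_norm_one_sub_le u) (norm_nonneg _)

/-- The product bound over a multiset of roots avoiding `1`. -/
theorem hadamardBookkeeping_multiset_prod_le (z : ℂ) (s : Multiset ℂ)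
    (hs : ∀ ρ ∈ s, 1 - ρ ≠ 0) :
    ‖(s.map (fun ρ => z - ρ)).prod‖ ≤ ‖(s.map (fun ρ => 1 - ρ)).prod‖ *
      Real.exp (-((1 - z) * (s.map (fun ρ => 1 / (1 - ρ))).sum).re
        + (1 / 2) * ‖1 - z‖ ^ 2 * (s.map (fun ρ : ℂ => (‖(1 : ℂ) - ρ‖ ^ 2)⁻¹)).sum) := by
  induction s using Multiset.induction_on with
  | empty => simp
  | cons ρ t ih =>
    have hρ : 1 - ρ ≠ 0 := hs ρ (Multiset.mem_cons_self ρ t)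
    have ht : ∀ ρ' ∈ t, 1 - ρ' ≠ 0 := fun ρ' h => hs ρ' (Multiset.mem_cons_of_mem h)
    have ih' := ih ht
    simp only [Multiset.map_cons, Multiset.prod_cons, Multiset.sum_cons, norm_mul]
    have hsplit : -((1 - z) * (1 / (1 - ρ) + (t.map (fun ρ => 1 / (1 - ρ))).sum)).re
        + (1 / 2) * ‖1 - z‖ ^ 2 * ((‖(1 : ℂ) - ρ‖ ^ 2)⁻¹
          + (t.map (fun ρ : ℂ => (‖(1 : ℂ) - ρ‖ ^ 2)⁻¹)).sum)
        = (-((1 - z) * (1 / (1 - ρ))).re + (1 / 2) * ‖1 - z‖ ^ 2 * (‖(1 : ℂ) - ρ‖ ^ 2)⁻¹)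
          + (-((1 - z) * (t.map (fun ρ => 1 / (1 - ρ))).sum).re
            + (1 / 2) * ‖1 - z‖ ^ 2 * (t.map (fun ρ : ℂ => (‖(1 : ℂ) - ρ‖ ^ 2)⁻¹)).sum) := by
      simp only [mul_add, Complex.add_re, neg_add]
      ring
    rw [hsplit, Real.exp_add]
    calc ‖z - ρ‖ * ‖(t.map (fun ρ => z - ρ)).prod‖
        ≤ (‖1 - ρ‖ * Real.exp (-((1 - z) * (1 / (1 - ρ))).re
            + (1 / 2) * ‖1 - z‖ ^ 2 * (‖(1 : ℂ) - ρ‖ ^ 2)⁻¹))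
          * (‖(t.map (fun ρ => 1 - ρ)).prod‖ *
            Real.exp (-((1 - z) * (t.map (fun ρ => 1 / (1 - ρ))).sum).re
              + (1 / 2) * ‖1 - z‖ ^ 2 * (t.map (fun ρ : ℂ => (‖(1 : ℂ) - ρ‖ ^ 2)⁻¹)).sum)) :=
          mul_le_mul (hadamardBookkeeping_factor_le z ρ hρ) ih' (norm_nonneg _)
            (mul_nonneg (norm_nonneg _) (Real.exp_nonneg _))
      _ = _ := by ring

/-- **Hadamard bookkeeping** (item `stmt-Parity-8827`, route decl
`Summit.Parity.BatemanHorn.Theses.AlmostPrimeZeros.HadamardBookkeeping`): for every complex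
polynomial `P` with `P(1) ≠ 0` and every `z`,
`‖P(z)‖ ≤ ‖P(1)‖ · exp(−Re[(1−z) P′(1)/P(1)] + ½‖1−z‖² Σ_ρ (‖1−ρ‖²)⁻¹)` (roots with multiplicity). -/
theorem hadamardBookkeeping_proof :
    Summit.Parity.BatemanHorn.Theses.AlmostPrimeZeros.HadamardBookkeeping := by
  unfold Summit.Parity.BatemanHorn.Theses.AlmostPrimeZeros.HadamardBookkeeping
  intro P hP1 z
  have hsplit : P.Splits := IsAlgClosed.splits P
  have hP0 : P ≠ 0 := fun h => hP1 (by simp [h])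
  have hroots : ∀ ρ ∈ P.roots, 1 - ρ ≠ 0 := by
    intro ρ hρ h1
    have hρ1 : ρ = 1 := by
      have := sub_eq_zero.mp h1
      exact this.symm
    rw [Polynomial.mem_roots hP0, hρ1] at hρ
    exact hP1 hρ
  have hz : P.eval z = P.leadingCoeff * (P.roots.map (fun ρ => z - ρ)).prod :=
    hsplit.eval_eq_prod_roots z
  have h1 : P.eval 1 = P.leadingCoeff * (P.roots.map (fun ρ => 1 - ρ)).prod :=
    hsplit.eval_eq_prod_roots 1
  have hlog : (Polynomial.derivative P).eval 1 / P.eval 1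
      = (P.roots.map (fun ρ => 1 / (1 - ρ))).sum :=
    hsplit.eval_derivative_div_eval_of_ne_zero hP1
  have hprod := hadamardBookkeeping_multiset_prod_le z P.roots hroots
  rw [hlog, hz, h1, norm_mul, norm_mul, mul_assoc]
  exact mul_le_mul_of_nonneg_left hprod (norm_nonneg _)

end Summit.Parity.BatemanHorn.Theorems
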